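import Literature.NumberTheory.Automorphic.JacquetRayFitting
import Mathlib.LinearAlgebra.FiniteDimensional.Defs
import HarnessLib

/-!
# The Hecke ray operator on `V^K`, V: LEVEL DEPTH — for a finite-dimensional Jacquet module, `[V^K] = V_N` for every level `K` deep enough
# (`K ⊆ U`, `U` the joint stabiliser of lifts of a basis; Casselman 1995 §3.3; rank-one kit R2e)

Topic `NumberTheory/Automorphic`; namespace `Representation` (sequel of ★ R2 `JacquetRayFitting`).  THEOREMS ONLY (no definition, no named fact, no instance, no
notation, no `sorry`).  Cell `hodgecm-mathlib`, F0∕P3c line LH6 (organ (S-i) `stub_StNoncuspidalMember` of `Cruxes/H413/Lines/F0_P3c_StCharTSPaydown.lean` :297),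
seat LH6-p02 (g0): the depth clause of the shell road — ★ R2d `smoothTrace_indicator_shell_eq` reads the character of `π` on `K aᵐ K` through `tr(π_N(a)^m | [V^K])`
with `[V^K] = range [·] ⊆ V_N`; for the FULL Jacquet trace one needs `[V^K] = V_N`, which holds as soon as `K` is contained in the joint stabiliser `U` of lifts of a
basis of the finite-dimensional `V_N` (ρ smooth): then `K ∩ M` fixes `V_N`, and ★ `range_fixedPointsMk_eq` (Jacquet's lemma, admissible `ρ`, Iwahori levels) gives
`[V^{K_n}] = V_N^{K_n ∩ M} = V_N`.  HONEST SCOPE: generic; nothing is instantiated at `U(3)`; HC_CM is proved only modulo the printed citations until rung 0 closes.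

* `exists_nhds_forall_fixedPoints_jacquetModule_eq_top` — `ρ` smooth, `V_N` finite-dimensional ⇒ `∃ U ∈ 𝓝 1, ∀ K ⊆ U, V_N^{K ∩ M} = V_N`.
* `exists_nhds_forall_range_fixedPointsMk_eq_top` — admissible `ρ`, Iwahori datum `𝓘`: `∃ U ∈ 𝓝 1, ∀ n, 𝓘.K n ⊆ U → [V^{K_n}] = V_N`; and `exists_range_fixedPointsMk_eq_top`
  (some level works, by `𝓘.hasBasis_K`).

## References
* [Casselman1995] W. Casselman, *Introduction to the theory of admissible representations of `p`-adic reductive groups* (draft 1995), §3.1, Thm. 3.3.3, Prop. 3.3.6.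
* [BernsteinZelevinsky1977] I. N. Bernstein, A. V. Zelevinsky, Ann. Sci. ÉNS 10 (1977), §1.8, §2.3.
-/

set_option autoImplicit false

open scoped BigOperators Pointwise Topology
open Literature.NumberTheory.Automorphic

namespace Representation

variable {k G V : Type*} [Field k] [CharZero k] [Group G] [TopologicalSpace G] [IsTopologicalGroup G]
  [AddCommGroup V] [Module k V] {ρ : Representation k G V}

omit [CharZero k] [IsTopologicalGroup G] in
/-- **Deep levels fix the Jacquet module**: for `ρ` smooth with FINITE-DIMENSIONAL Jacquet module `V_N` there is a neighbourhood `U` of `1` in `G` such that every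
subgroup `K ⊆ U` satisfies `V_N^{K ∩ M} = V_N` (`U` = the joint stabiliser of lifts of a basis of `V_N`). [cite: Casselman1995, §3.1; Thm. 3.3.3] [cite: BernsteinZelevinsky1977, §1.8] -/
theorem exists_nhds_forall_fixedPoints_jacquetModule_eq_top (t : ParabolicTriple G) (hρ : ρ.IsSmooth)
    [FiniteDimensional k (t.restrict ρ).Coinvariants] :
    ∃ U ∈ 𝓝 (1 : G), ∀ K : Subgroup G, (K : Set G) ⊆ U → (ρ.jacquetModule t).fixedPoints (K.comap t.M.subtype) = ⊤ := by
  classical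
  -- a basis of `V_N` and lifts of its vectors
  let b := Module.finBasis k (t.restrict ρ).Coinvariants
  have hlift : ∀ i, ∃ v : V, Coinvariants.mk (t.restrict ρ) v = b i := fun i => Coinvariants.mk_surjective _ (b i)
  choose v hv using hlift
  -- the joint stabiliser
  refine ⟨⋂ i, (ρ.stabilizerSubgroup (v i) : Set G), ?_, fun K hK => ?_⟩
  · exact (isOpen_iInter_of_finite fun i => hρ (v i)).mem_nhds (Set.mem_iInter.2 fun i => (ρ.stabilizerSubgroup (v i)).one_mem)
  · rw [eq_top_iff]
    intro x _
    rw [mem_fixedPoints]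
    intro m hm
    have hmK : (m : G) ∈ K := Subgroup.mem_comap.1 hm
    have hfix : ∀ i, ρ.jacquetModule t m (b i) = b i := fun i => by
      rw [← hv i, jacquetModule_mk]
      exact congrArg _ ((ρ.mem_stabilizerSubgroup (v i) m).1 (Set.mem_iInter.1 (hK hmK) i))
    -- `x` is a combination of the `b i`
    rw [← b.sum_repr x, map_sum]
    exact Finset.sum_congr rfl fun i _ => by rw [map_smul, hfix i]

/-- **`[V^{K_n}] = V_N` at every deep enough Iwahori level** (admissible `ρ`, finite-dimensional `V_N`): `∃ U ∈ 𝓝 1, ∀ n, 𝓘.K n ⊆ U → range [·]_{K_n} = V_N`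
(the previous lemma + Jacquet's lemma ★ `range_fixedPointsMk_eq`). [cite: Casselman1995, Thm. 3.3.3, Prop. 3.3.6] -/
theorem exists_nhds_forall_range_fixedPointsMk_eq_top (t : ParabolicTriple G) (𝓘 : t.IwahoriDatum) (hρa : ρ.IsAdmissible)
    [FiniteDimensional k (t.restrict ρ).Coinvariants] :
    ∃ U ∈ 𝓝 (1 : G), ∀ n : ℕ, ((𝓘.K n : Set G) ⊆ U) → LinearMap.range (ρ.fixedPointsMk t (𝓘.K n)) = ⊤ := by
  obtain ⟨U, hU, h⟩ := exists_nhds_forall_fixedPoints_jacquetModule_eq_top t hρa.1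
  refine ⟨U, hU, fun n hn => ?_⟩
  rw [range_fixedPointsMk_eq t 𝓘 hρa n, h (𝓘.K n) hn]

/-- **Some Iwahori level has `[V^{K_n}] = V_N`** (admissible `ρ`, finite-dimensional `V_N`; ★ `IwahoriDatum.hasBasis_K`). [cite: Casselman1995, Thm. 3.3.3, Prop. 3.3.6] -/
theorem exists_range_fixedPointsMk_eq_top (t : ParabolicTriple G) (𝓘 : t.IwahoriDatum) (hρa : ρ.IsAdmissible)
    [FiniteDimensional k (t.restrict ρ).Coinvariants] :
    ∃ n : ℕ, LinearMap.range (ρ.fixedPointsMk t (𝓘.K n)) = ⊤ := by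
  obtain ⟨U, hU, h⟩ := exists_nhds_forall_range_fixedPointsMk_eq_top t 𝓘 hρa
  obtain ⟨n, hn⟩ := 𝓘.hasBasis_K U hU
  exact ⟨n, h n hn⟩

end Representation
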